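import Summits.Parity.GeneralizedHardyLittlewood.Theorems.GreenTaoLevelTwoGITwoCyclicInverseCauchySchwarz

/-!
# Route `GreenTaoLevelTwo`, crux `GITwo` (stmt-Parity-21275), line `birth`, stub `stub_cyclicInverse`:
# averaging over translates of a set (GT08a arXiv Lemma 20, complex form)

Thirty-ninth helper file toward the XL stub `stub_cyclicInverse` (B. Green, T. Tao, *An inverse
theorem for the Gowers `U³(G)` norm*, arXiv:math/0503014, Thm. 68 = PEMS 51 (2008) Thm. 12.8).
arXiv Lemma 20 ("averaging on a subgroup", here the whole group `ℤ/Nℤ`): a global average is an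
average of averages over translates `x₁ + B`, so some translate does at least as well.  Used in §9
Steps 2 and 3 (blocks C12/C13: "applying Lemma (avg-1) we can find `x₁ ∈ G` such that …").  Sum
form, def-free, complex-valued:

* `sum_sum_translate_eq` — `Σ_{x₁} Σ_{x∈B} g(x + x₁) = #B · Σ_x g(x)`;
* `exists_translate_norm_sum_ge` — **arXiv Lemma 20**: some `x₁` has
  `#B · ‖Σ_x g(x)‖ ≤ N · ‖Σ_{x∈B} g(x + x₁)‖`.

References: [GreenTao2008U3Inverse] arXiv:math/0503014, Lemma 20.
-/

noncomputable section

namespace Summit.Parity.GeneralizedHardyLittlewood.GreenTaoLevelTwoGITwoCyclicInverse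

open Finset

variable {N : ℕ} [NeZero N]

/-- `Σ_{x₁} Σ_{x∈B} g(x + x₁) = #B · Σ_x g(x)`. [folklore] -/
theorem sum_sum_translate_eq {γ : Type*} [AddCommMonoid γ] (B : Finset (ZMod N)) (g : ZMod N → γ) :
    ∑ x₁ : ZMod N, ∑ x ∈ B, g (x + x₁) = #B • ∑ x : ZMod N, g x := by
  rw [Finset.sum_comm]
  have h : ∀ x ∈ B, ∑ x₁ : ZMod N, g (x + x₁) = ∑ y : ZMod N, g y := fun x _ =>
    (Equiv.sum_comp (Equiv.addLeft x) g)
  rw [sum_congr rfl h, sum_const]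

/-- **GT08a arXiv Lemma 20 (averaging over translates), complex sum form**: for `g : ℤ/Nℤ → ℂ` and a
finset `B` some translate satisfies `#B · ‖Σ_x g(x)‖ ≤ N · ‖Σ_{x∈B} g(x + x₁)‖`.
[cite: GreenTao2008U3Inverse, Lemma 20] -/
theorem exists_translate_norm_sum_ge (B : Finset (ZMod N)) (g : ZMod N → ℂ) :
    ∃ x₁ : ZMod N, (#B : ℝ) * ‖∑ x : ZMod N, g x‖ ≤ N * ‖∑ x ∈ B, g (x + x₁)‖ := by
  obtain ⟨x₁, -, hmax⟩ := exists_max_image (univ : Finset (ZMod N))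
    (fun x₁ => ‖∑ x ∈ B, g (x + x₁)‖) univ_nonempty
  refine ⟨x₁, ?_⟩
  have h1 : (#B : ℝ) * ‖∑ x : ZMod N, g x‖ = ‖∑ x₁ : ZMod N, ∑ x ∈ B, g (x + x₁)‖ := by
    rw [sum_sum_translate_eq, nsmul_eq_mul, norm_mul, Complex.norm_natCast]
  rw [h1]
  calc ‖∑ x₁ : ZMod N, ∑ x ∈ B, g (x + x₁)‖ ≤ ∑ x₁ : ZMod N, ‖∑ x ∈ B, g (x + x₁)‖ :=
        norm_sum_le _ _
    _ ≤ ∑ x₁ : ZMod N, ‖∑ x ∈ B, g (x + x₁)‖ := le_rfl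
    _ ≤ ∑ _x₁ : ZMod N, ‖∑ x ∈ B, g (x + x₁)‖ := sum_le_sum fun y hy => hmax y hy
    _ = N * ‖∑ x ∈ B, g (x + x₁)‖ := by rw [sum_const, card_univ, ZMod.card, nsmul_eq_mul]

end Summit.Parity.GeneralizedHardyLittlewood.GreenTaoLevelTwoGITwoCyclicInverse
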